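import Summits.Ventures.PercRepro.RankLevelSetUpChain

/-! # RankLevelSetUpSeriesClass — THE EXACT DECOMPOSITION OF (↑) AT LEVEL `4` ALONG A SERIES CLASS (night-1 g38;
dossier §50; on `RankLevelSetUpChain`)

In the dual `N = M✶` (rank `4`, loopless) let `P = cl✶ {p}` be the parallel class of `p` (a SERIES class of `M`),
`E' = E ∖ P`, `q = #P ≥ 3`, `b ∉ P`. A bi-spanning `4`-set through `b` (an `N`-basis) meets `P` in at most one
element, a bi-spanning `5`-set avoiding `b` in at most two; sorting by `#(Z ∩ P)` gives `T_4 = A_4 + q · g_3` and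
`V_5 = Ā_5 + q · ḡ_4 + C(q,2) · ḡ_3` (here as the inequalities **`through_four_le`**, **`avoid_five_ge`**), where
`g`/`ḡ` are the through-`b` / avoid-`b` bi-spanning profiles of `N ／ P = (M ＼ P)✶` (**`throughHat`**,
**`avoidHat`**: `insert p U` and `insert p (E' ∖ U)` spanning) and `A`/`Ā` the profiles of the MIXED family of the
elementary quotient pair `N ＼ P → N ／ P` (**`upFull`**, **`avoidFull`**: `W` spanning `N`, `insert p (E' ∖ W)`
spanning). **`UpSeriesClaim`** is the statement `A_4 ≤ Ā_5 + ḡ_3` (a `Prop`, NOT asserted; census-clean on every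
loopless rank-`4` matroid with `≤ 9` elements, kit j332342). The successor modules
`RankLevelSetUpSeriesClassDual` / `RankLevelSetUpSeriesClassFour` draw the consequence: the series-triple case of
(↑) at level `4` — hence of (★★) at level `5` — IS the claim. Every declaration has a docstring; imports: the
cell's own modules and Mathlib only. Axioms: standard. -/

namespace PercRepro

open Set Matroid
variable {α : Type}

/-! ## Parallel classes and spanning -/

/-- **Spanning through a parallel class**: for `S ⊆ cl {p}` nonempty and `X ⊆ E`, `X ∪ S` spans iff `insert p X`
spans (`p` a nonloop): both closures equal `cl (X ∪ cl {p})`. -/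
lemma spanning_union_iff_insert (N : Matroid α) (hnl : ∀ e ∈ N.E, N.IsNonloop e) {p : α} (hp : N.IsNonloop p)
    {S X : Set α} (hSP : S ⊆ N.closure {p}) (hS : S.Nonempty) (hXE : X ⊆ N.E) :
    N.Spanning (X ∪ S) ↔ N.Spanning (insert p X) := by
  have hPE : N.closure {p} ⊆ N.E := N.closure_subset_ground _
  have hcl : N.closure (X ∪ S) = N.closure (insert p X) := by
    obtain ⟨s, hs⟩ := hS
    have hs' : s ∈ N.closure {p} := hSP hs
    have hsnl : N.IsNonloop s := hnl s (hPE hs')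
    have hcls : N.closure {s} = N.closure {p} := hsnl.closure_eq_of_mem_closure hs'
    refine subset_antisymm ?_ ?_
    · -- `X ∪ S ⊆ X ∪ cl {p} ⊆ cl (insert p X)`
      refine N.closure_subset_closure_of_subset_closure ?_
      intro x hx
      rcases hx with hx | hx
      · exact N.mem_closure_of_mem' (Set.mem_insert_of_mem p hx) (hXE hx)
      · have : x ∈ N.closure {p} := hSP hx
        have hpX : {p} ⊆ insert p X := Set.singleton_subset_iff.mpr (Set.mem_insert p X)
        exact N.closure_subset_closure hpX this
    · -- `insert p X ⊆ cl (X ∪ S)`: `p ∈ cl {s} ⊆ cl (X ∪ S)`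
      refine N.closure_subset_closure_of_subset_closure ?_
      intro x hx
      rcases hx with rfl | hx
      · have hps : x ∈ N.closure {s} := by rw [hcls]; exact N.mem_closure_of_mem' rfl hp.mem_ground
        have hsX : {s} ⊆ X ∪ S := Set.singleton_subset_iff.mpr (Set.mem_union_right X hs)
        exact N.closure_subset_closure hsX hps
      · exact N.mem_closure_of_mem' (Set.mem_union_left S hx) (hXE hx)
  rw [Matroid.spanning_iff_closure_eq (Set.union_subset hXE (hSP.trans hPE)),
    Matroid.spanning_iff_closure_eq (Set.insert_subset hp.mem_ground hXE), hcl]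

/-- A spanning set of a matroid of rank `r` has at least `r` elements. -/
lemma eRank_le_encard_of_spanning {N : Matroid α} {X : Set α} (hX : N.Spanning X) : N.eRank ≤ X.encard := by
  rw [← hX.eRk_eq]; exact N.eRk_le_encard X

/-- **A spanning set of a rank-`4` matroid with `4` elements contains no two distinct parallel elements**: deleting
one of them would leave a spanning `3`-set. -/
lemma not_two_parallel_of_spanning_four {N : Matroid α} [N.Finite] (hnl : ∀ e ∈ N.E, N.IsNonloop e)
    (hr : N.eRank = 4) {W : Set α}
    (hW : N.Spanning W) (hW4 : W.ncard = 4) {p : α} {x y : α} (hx : x ∈ W) (hy : y ∈ W)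
    (hxy : x ≠ y) (hxP : x ∈ N.closure {p}) (hyP : y ∈ N.closure {p}) : False := by
  have hWfin : W.Finite := N.ground_finite.subset hW.subset_ground
  have hxnl : N.IsNonloop x := hnl x (hW.subset_ground hx)
  have hclx : N.closure {x} = N.closure {p} := hxnl.closure_eq_of_mem_closure hxP
  have hy' : y ∈ N.closure (W \ {y}) := by
    have : y ∈ N.closure {x} := by rw [hclx]; exact hyP
    have hxW' : x ∈ W \ {y} := ⟨hx, fun h => hxy (by simpa using h)⟩
    exact N.closure_subset_closure (Set.singleton_subset_iff.mpr hxW') this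
  have hsp : N.Spanning (W \ {y}) := (spanning_sdiff_singleton_iff hW hy).mpr hy'
  have h1 := eRank_le_encard_of_spanning hsp
  rw [hr, (hWfin.subset Set.sdiff_subset).encard_eq_coe_toFinset_card,
    ← Set.ncard_eq_toFinset_card _ (hWfin.subset Set.sdiff_subset), Set.ncard_sdiff_singleton_of_mem hy,
    hW4] at h1
  norm_num at h1

/-! ## The four families of a quotient pair -/

/-- **The through-`b` members of the mixed family at level `k`** (`A_k`): `W ⊆ E ∖ cl {p}` with `#W = k`, `b ∈ W`,
`W` spanning `N`, and `insert p ((E ∖ cl {p}) ∖ W)` spanning `N`. -/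
def upFull (N : Matroid α) (p b : α) (k : ℕ) : Set (Set α) :=
  {W | W ⊆ N.E \ N.closure {p} ∧ W.ncard = k ∧ b ∈ W ∧ N.Spanning W ∧
    N.Spanning (insert p ((N.E \ N.closure {p}) \ W))}

/-- **The avoid-`b` members of the mixed family at level `k`** (`Ā_k`). -/
def avoidFull (N : Matroid α) (p b : α) (k : ℕ) : Set (Set α) :=
  {Z | Z ⊆ N.E \ N.closure {p} ∧ Z.ncard = k ∧ b ∉ Z ∧ N.Spanning Z ∧
    N.Spanning (insert p ((N.E \ N.closure {p}) \ Z))}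

/-- **The through-`b` bi-spanning sets of the contraction `N ／ cl {p}` at level `k`** (`g_k`): `U ⊆ E ∖ cl {p}`
with `#U = k`, `b ∈ U`, `insert p U` and `insert p ((E ∖ cl {p}) ∖ U)` spanning `N`. -/
def throughHat (N : Matroid α) (p b : α) (k : ℕ) : Set (Set α) :=
  {U | U ⊆ N.E \ N.closure {p} ∧ U.ncard = k ∧ b ∈ U ∧ N.Spanning (insert p U) ∧
    N.Spanning (insert p ((N.E \ N.closure {p}) \ U))}

/-- **The avoid-`b` bi-spanning sets of the contraction `N ／ cl {p}` at level `k`** (`ḡ_k`). -/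
def avoidHat (N : Matroid α) (p b : α) (k : ℕ) : Set (Set α) :=
  {D | D ⊆ N.E \ N.closure {p} ∧ D.ncard = k ∧ b ∉ D ∧ N.Spanning (insert p D) ∧
    N.Spanning (insert p ((N.E \ N.closure {p}) \ D))}

/-- **THE CLAIM ON ELEMENTARY QUOTIENT PAIRS** (night-1 g38; a `Prop`, NOT asserted): `A_4 ≤ Ā_5 + ḡ_3` — the
through-`b` members of the mixed family at level `4` are at most the avoid-`b` members at level `5` plus the
avoid-`b` bi-spanning `3`-sets of the contraction. Census: 0 failures on every loopless rank-`4` matroid with `≤ 9`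
elements, every class and every `b` (13,635,459 instances, kit j332342), and its Hall forms; tight exactly when
`E ∖ cl {p} ∖ {b}` is a hyperplane missing `p`. -/
def UpSeriesClaim (N : Matroid α) (p b : α) : Prop :=
  (upFull N p b 4).ncard ≤ (avoidFull N p b 5).ncard + (avoidHat N p b 3).ncard

variable (N : Matroid α) [N.Finite]

/-- The four families are finite. -/
lemma upFull_finite (p b : α) (k : ℕ) : (upFull N p b k).Finite :=
  (N.ground_finite.subset Set.sdiff_subset).finite_subsets.subset (fun _ h => h.1)

/-- The four families are finite. -/
lemma avoidFull_finite (p b : α) (k : ℕ) : (avoidFull N p b k).Finite :=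
  (N.ground_finite.subset Set.sdiff_subset).finite_subsets.subset (fun _ h => h.1)

/-- The four families are finite. -/
lemma throughHat_finite (p b : α) (k : ℕ) : (throughHat N p b k).Finite :=
  (N.ground_finite.subset Set.sdiff_subset).finite_subsets.subset (fun _ h => h.1)

/-- The four families are finite. -/
lemma avoidHat_finite (p b : α) (k : ℕ) : (avoidHat N p b k).Finite :=
  (N.ground_finite.subset Set.sdiff_subset).finite_subsets.subset (fun _ h => h.1)

/-! ## The bi-spanning family and its sorting along the class -/

/-- **The bi-spanning `k`-sets** of `N`: `W ⊆ E` with `#W = k`, `W` and `E ∖ W` spanning — the bi-independent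
sets of the dual (`biIndep_eq_biSpan_dual`). -/
def biSpan (k : ℕ) : Set (Set α) :=
  {W | W ⊆ N.E ∧ W.ncard = k ∧ N.Spanning W ∧ N.Spanning (N.E \ W)}

omit [N.Finite] in
/-- The complement of a set disjoint from `P ⊆ E` splits as `((E ∖ P) ∖ W) ∪ P`. -/
lemma compl_eq_union_of_disjoint {P W : Set α} (hPE : P ⊆ N.E) (hWP : W ∩ P = ∅) :
    N.E \ W = ((N.E \ P) \ W) ∪ P := by
  ext x
  simp only [Set.mem_sdiff, Set.mem_union]
  constructor
  · rintro ⟨hxE, hxW⟩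
    by_cases hxP : x ∈ P
    · exact Or.inr hxP
    · exact Or.inl ⟨⟨hxE, hxP⟩, hxW⟩
  · rintro (⟨⟨hxE, -⟩, hxW⟩ | hxP)
    · exact ⟨hxE, hxW⟩
    · refine ⟨hPE hxP, fun hxW => ?_⟩
      have : x ∈ W ∩ P := ⟨hxW, hxP⟩
      rw [hWP] at this
      exact this

omit [N.Finite] in
/-- The complement of `D ∪ S` with `D ⊆ E ∖ P` and `S ⊆ P` splits as `((E ∖ P) ∖ D) ∪ (P ∖ S)`. -/
lemma compl_union_eq {P D S : Set α} (hPE : P ⊆ N.E) (hD : D ⊆ N.E \ P) (hS : S ⊆ P) :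
    N.E \ (D ∪ S) = ((N.E \ P) \ D) ∪ (P \ S) := by
  ext x
  simp only [Set.mem_sdiff, Set.mem_union, not_or]
  constructor
  · rintro ⟨hxE, hxD, hxS⟩
    by_cases hxP : x ∈ P
    · exact Or.inr ⟨hxP, hxS⟩
    · exact Or.inl ⟨⟨hxE, hxP⟩, hxD⟩
  · rintro (⟨⟨hxE, hxP⟩, hxD⟩ | ⟨hxP, hxS⟩)
    · exact ⟨hxE, hxD, fun h => hxP (hS h)⟩
    · exact ⟨hPE hxP, fun h => (hD h).2 hxP, hxS⟩

omit [N.Finite] in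
/-- A subset of `E ∖ P` is disjoint from `P`. -/
lemma inter_eq_empty_of_subset_compl {P D : Set α} (hD : D ⊆ N.E \ P) : D ∩ P = ∅ := by
  ext x; simp only [Set.mem_inter_iff, Set.mem_empty_iff_false, iff_false, not_and]
  exact fun hx hxP => (hD hx).2 hxP

/-- **THE THROUGH-`b` SIDE SORTED BY THE CLASS**: `T_4 ≤ A_4 + q · g_3` — a bi-spanning `4`-set through `b` meets
the class `P = cl {p}` in at most one element (`not_two_parallel_of_spanning_four`); those disjoint from `P` are
members of the mixed family, and those meeting it in `{x}` inject into `P × g_3` via `W ↦ (W ∩ P, W ∖ P)`. -/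
theorem through_four_le (hnl : ∀ e ∈ N.E, N.IsNonloop e) (hr : N.eRank = 4) {p : α} (hp : p ∈ N.E)
    (hq : 2 ≤ (N.closure {p}).ncard) {b : α} (hbP : b ∉ N.closure {p}) :
    {W ∈ biSpan N 4 | b ∈ W}.ncard ≤
      (upFull N p b 4).ncard + (N.closure {p}).ncard * (throughHat N p b 3).ncard := by
  classical
  set P := N.closure {p} with hPdef
  have hPE : P ⊆ N.E := N.closure_subset_ground _
  have hpP : p ∈ P := N.mem_closure_of_mem' rfl hp
  have hpnl : N.IsNonloop p := hnl p hp
  have hPfin : P.Finite := N.ground_finite.subset hPE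
  set T := {W ∈ biSpan N 4 | b ∈ W} with hT
  set T₀ := {W ∈ T | W ∩ P = ∅} with hT₀
  set T₁ := {W ∈ T | W ∩ P ≠ ∅} with hT₁
  have hTfin : T.Finite := N.ground_finite.finite_subsets.subset (fun _ h => h.1.1)
  have hsplit : T = T₀ ∪ T₁ := by
    ext W; simp only [hT₀, hT₁, Set.mem_union, Set.mem_setOf_eq]; tauto
  have h0 : T₀.ncard ≤ (upFull N p b 4).ncard := by
    refine Set.ncard_le_ncard ?_ (upFull_finite N p b 4)
    rintro W ⟨⟨⟨hWE, hW4, hWs, hWc⟩, hbW⟩, hWP⟩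
    refine ⟨?_, hW4, hbW, hWs, ?_⟩
    · intro x hx
      refine ⟨hWE hx, fun hxP => ?_⟩
      have : x ∈ W ∩ P := ⟨hx, hxP⟩
      rw [hWP] at this; exact this
    · rw [compl_eq_union_of_disjoint N hPE hWP] at hWc
      exact (spanning_union_iff_insert N hnl hpnl (X := (N.E \ P) \ W) (subset_refl P) ⟨p, hpP⟩
        (Set.sdiff_subset.trans Set.sdiff_subset)).mp hWc
  have h1 : T₁.ncard ≤ (N.closure {p}).ncard * (throughHat N p b 3).ncard := by
    have hprod : ({S | S ⊆ P ∧ S.ncard = 1} ×ˢ throughHat N p b 3).ncard =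
        P.ncard * (throughHat N p b 3).ncard := by
      rw [Set.ncard_prod, Set.ncard_powerset_ncard hPfin, Nat.choose_one_right]
    rw [← hprod]
    refine Set.ncard_le_ncard_of_injOn (fun W => (W ∩ P, W \ P)) ?_ ?_
      ((hPfin.finite_subsets.subset (fun _ h => h.1)).prod (throughHat_finite N p b 3))
    · rintro W ⟨⟨⟨hWE, hW4, hWs, hWc⟩, hbW⟩, hWP⟩
      have hWfin : W.Finite := N.ground_finite.subset hWE
      obtain ⟨x, hx⟩ : (W ∩ P).Nonempty := Set.nonempty_iff_ne_empty.mpr hWP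
      have hsing : W ∩ P = {x} := by
        ext y
        constructor
        · intro hy
          by_contra hyx
          exact not_two_parallel_of_spanning_four hnl hr hWs hW4 (p := p) hy.1 hx.1
            (fun h => hyx (by rw [Set.mem_singleton_iff]; exact h)) hy.2 hx.2
        · intro hy; rw [Set.mem_singleton_iff] at hy; rw [hy]; exact hx
      have hcard1 : (W ∩ P).ncard = 1 := by rw [hsing, Set.ncard_singleton]
      refine ⟨⟨Set.inter_subset_right, hcard1⟩, ?_, ?_, ?_, ?_, ?_⟩
      · intro y hy; exact ⟨hWE hy.1, hy.2⟩
      · have h := Set.ncard_inter_add_ncard_sdiff_eq_ncard W P hWfin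
        rw [hcard1, hW4] at h
        show (W \ P).ncard = 3
        omega
      · exact ⟨hbW, hbP⟩
      · have hW' : W = (W \ P) ∪ (W ∩ P) := by rw [Set.sdiff_union_inter]
        rw [hW'] at hWs
        exact (spanning_union_iff_insert N hnl hpnl Set.inter_subset_right ⟨x, hx⟩
          (Set.sdiff_subset.trans hWE)).mp hWs
      · have hcompl : N.E \ W = ((N.E \ P) \ (W \ P)) ∪ (P \ W) := by
          ext y
          simp only [Set.mem_sdiff, Set.mem_union, not_and, not_not]
          constructor
          · rintro ⟨hyE, hyW⟩
            by_cases hyP : y ∈ P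
            · exact Or.inr ⟨hyP, hyW⟩
            · exact Or.inl ⟨⟨hyE, hyP⟩, fun h => absurd h hyW⟩
          · rintro (⟨⟨hyE, hyP⟩, h⟩ | ⟨hyP, hyW⟩)
            · exact ⟨hyE, fun hyW => hyP (h hyW)⟩
            · exact ⟨hPE hyP, hyW⟩
        rw [hcompl] at hWc
        have hne : (P \ W).Nonempty := by
          by_contra hemp
          rw [Set.not_nonempty_iff_eq_empty, Set.sdiff_eq_empty] at hemp
          have : P ⊆ W ∩ P := fun y hy => ⟨hemp hy, hy⟩
          have hle := Set.ncard_le_ncard this (hWfin.subset Set.inter_subset_left)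
          rw [hcard1] at hle
          omega
        exact (spanning_union_iff_insert N hnl hpnl Set.sdiff_subset hne
          (Set.sdiff_subset.trans Set.sdiff_subset)).mp hWc
    · intro W _ W' _ heq
      simp only [Prod.mk.injEq] at heq
      rw [← Set.inter_union_sdiff W P, ← Set.inter_union_sdiff W' P, heq.1, heq.2]
  calc T.ncard = (T₀ ∪ T₁).ncard := by rw [hsplit]
    _ ≤ T₀.ncard + T₁.ncard := Set.ncard_union_le _ _
    _ ≤ _ := Nat.add_le_add h0 h1

/-- **THE AVOID-`b` SIDE SORTED BY THE CLASS**: `Ā_5 + q · ḡ_4 + C(q,2) · ḡ_3 ≤ V_5` — the avoid-`b` members of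
the mixed family at level `5`, the sets `D ∪ {x}` (`D ∈ ḡ_4`, `x ∈ P`) and the sets `D ∪ S` (`D ∈ ḡ_3`,
`S ⊆ P` a pair) are pairwise distinct bi-spanning `5`-sets avoiding `b` (sorted by `#(Z ∩ P)`), when `#P ≥ 3`. -/
theorem avoid_five_ge (hnl : ∀ e ∈ N.E, N.IsNonloop e) {p : α} (hp : p ∈ N.E)
    (hq : 3 ≤ (N.closure {p}).ncard) {b : α} (hbP : b ∉ N.closure {p}) :
    (avoidFull N p b 5).ncard + (N.closure {p}).ncard * (avoidHat N p b 4).ncard +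
      (N.closure {p}).ncard.choose 2 * (avoidHat N p b 3).ncard ≤ {Z ∈ biSpan N 5 | b ∉ Z}.ncard := by
  classical
  set P := N.closure {p} with hPdef
  have hPE : P ⊆ N.E := N.closure_subset_ground _
  have hpP : p ∈ P := N.mem_closure_of_mem' rfl hp
  have hpnl : N.IsNonloop p := hnl p hp
  have hPfin : P.Finite := N.ground_finite.subset hPE
  set V := {Z ∈ biSpan N 5 | b ∉ Z} with hV
  have hVfin : V.Finite := N.ground_finite.finite_subsets.subset (fun _ h => h.1.1)
  -- the three pieces, sorted by `#(Z ∩ P)`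
  let Vk : ℕ → Set (Set α) := fun k => {Z ∈ V | (Z ∩ P).ncard = k}
  have hVk : ∀ k, Vk k ⊆ V := fun k _ h => h.1
  have hdisj : ∀ k l, k ≠ l → Disjoint (Vk k) (Vk l) := by
    intro k l hkl
    rw [Set.disjoint_left]
    rintro Z ⟨-, hk⟩ ⟨-, hl⟩
    exact hkl (hk.symm.trans hl)
  -- generic injection `(S, D) ↦ D ∪ S` for `#S = s`, `D ∈ avoidHat (5 - s)`
  have hinj : ∀ s : ℕ, 1 ≤ s → s ≤ 5 → s + 1 ≤ P.ncard →
      ({S | S ⊆ P ∧ S.ncard = s} ×ˢ avoidHat N p b (5 - s)).ncard ≤ (Vk s).ncard := by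
    intro s hs1 hs5 hsP
    refine Set.ncard_le_ncard_of_injOn (fun x => x.2 ∪ x.1) ?_ ?_ (hVfin.subset (hVk s))
    · rintro ⟨S, D⟩ hx
      obtain ⟨hx1, hx2⟩ := Set.mem_prod.mp hx
      dsimp only at hx1 hx2
      obtain ⟨hSP, hSs⟩ := hx1
      obtain ⟨hDE, hDk, hbD, hDs, hDc⟩ := hx2
      simp only
      have hDfin : D.Finite := N.ground_finite.subset (hDE.trans Set.sdiff_subset)
      have hSfin : S.Finite := hPfin.subset hSP
      have hdj : Disjoint D S := by
        rw [Set.disjoint_left]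
        intro x hxD hxS
        exact (hDE hxD).2 (hSP hxS)
      have hSne : S.Nonempty := by
        rw [← Set.ncard_pos hSfin]; omega
      have hPSne : (P \ S).Nonempty := by
        by_contra hemp
        rw [Set.not_nonempty_iff_eq_empty, Set.sdiff_eq_empty] at hemp
        have := Set.ncard_le_ncard hemp hSfin
        omega
      refine ⟨⟨⟨Set.union_subset (hDE.trans Set.sdiff_subset) (hSP.trans hPE), ?_, ?_, ?_⟩, ?_⟩, ?_⟩
      · rw [Set.ncard_union_eq hdj hDfin hSfin, hDk, hSs]; omega
      · exact (spanning_union_iff_insert N hnl hpnl hSP hSne (hDE.trans Set.sdiff_subset)).mpr hDs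
      · rw [compl_union_eq N hPE hDE hSP]
        exact (spanning_union_iff_insert N hnl hpnl Set.sdiff_subset hPSne
          (Set.sdiff_subset.trans Set.sdiff_subset)).mpr hDc
      · rintro (hbD' | hbS)
        · exact hbD hbD'
        · exact hbP (hSP hbS)
      · have : (D ∪ S) ∩ P = S := by
          ext x
          simp only [Set.mem_inter_iff, Set.mem_union]
          constructor
          · rintro ⟨hx | hx, hxP⟩
            · exact absurd hxP (hDE hx).2
            · exact hx
          · intro hx; exact ⟨Or.inr hx, hSP hx⟩
        rw [this, hSs]
    · rintro ⟨S, D⟩ hx ⟨S', D'⟩ hx' heq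
      obtain ⟨hx1, hx2⟩ := Set.mem_prod.mp hx
      obtain ⟨hx1', hx2'⟩ := Set.mem_prod.mp hx'
      dsimp only at hx1 hx2 hx1' hx2'
      have hSP : S ⊆ P := hx1.1
      have hDE : D ⊆ N.E \ P := hx2.1
      have hS'P : S' ⊆ P := hx1'.1
      have hD'E : D' ⊆ N.E \ P := hx2'.1
      simp only at heq
      have hS : S = (D ∪ S) ∩ P := by
        ext x; simp only [Set.mem_inter_iff, Set.mem_union]
        constructor
        · intro hx; exact ⟨Or.inr hx, hSP hx⟩
        · rintro ⟨hx | hx, hxP⟩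
          · exact absurd hxP (hDE hx).2
          · exact hx
      have hS' : S' = (D' ∪ S') ∩ P := by
        ext x; simp only [Set.mem_inter_iff, Set.mem_union]
        constructor
        · intro hx; exact ⟨Or.inr hx, hS'P hx⟩
        · rintro ⟨hx | hx, hxP⟩
          · exact absurd hxP (hD'E hx).2
          · exact hx
      have hD : D = (D ∪ S) \ P := by
        ext x; simp only [Set.mem_sdiff, Set.mem_union]
        constructor
        · intro hx; exact ⟨Or.inl hx, (hDE hx).2⟩
        · rintro ⟨hx | hx, hxP⟩
          · exact hx
          · exact absurd (hSP hx) hxP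
      have hD' : D' = (D' ∪ S') \ P := by
        ext x; simp only [Set.mem_sdiff, Set.mem_union]
        constructor
        · intro hx; exact ⟨Or.inl hx, (hD'E hx).2⟩
        · rintro ⟨hx | hx, hxP⟩
          · exact hx
          · exact absurd (hS'P hx) hxP
      rw [Prod.mk.injEq]
      refine ⟨?_, ?_⟩
      · rw [hS, hS', heq]
      · rw [hD, hD', heq]
  have h0 : (avoidFull N p b 5).ncard ≤ (Vk 0).ncard := by
    refine Set.ncard_le_ncard ?_ (hVfin.subset (hVk 0))
    rintro Z ⟨hZE, hZ5, hbZ, hZs, hZc⟩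
    have hZP : Z ∩ P = ∅ := inter_eq_empty_of_subset_compl N hZE
    refine ⟨⟨⟨hZE.trans Set.sdiff_subset, hZ5, hZs, ?_⟩, hbZ⟩, by rw [hZP, Set.ncard_empty]⟩
    rw [compl_eq_union_of_disjoint N hPE hZP]
    exact (spanning_union_iff_insert N hnl hpnl (X := (N.E \ P) \ Z) (subset_refl P) ⟨p, hpP⟩
      (Set.sdiff_subset.trans Set.sdiff_subset)).mpr hZc
  have h1 := hinj 1 le_rfl (by norm_num) (by omega)
  have h2 := hinj 2 (by norm_num) (by norm_num) hq
  rw [Set.ncard_prod, Set.ncard_powerset_ncard hPfin, Nat.choose_one_right] at h1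
  rw [Set.ncard_prod, Set.ncard_powerset_ncard hPfin] at h2
  have hunion : (Vk 0 ∪ Vk 1 ∪ Vk 2).ncard = (Vk 0).ncard + (Vk 1).ncard + (Vk 2).ncard := by
    rw [Set.ncard_union_eq ?_ ((hVfin.subset (hVk 0)).union (hVfin.subset (hVk 1))) (hVfin.subset (hVk 2)),
      Set.ncard_union_eq (hdisj 0 1 (by norm_num)) (hVfin.subset (hVk 0)) (hVfin.subset (hVk 1))]
    exact Set.disjoint_union_left.mpr ⟨hdisj 0 2 (by norm_num), hdisj 1 2 (by norm_num)⟩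
  calc (avoidFull N p b 5).ncard + P.ncard * (avoidHat N p b 4).ncard + P.ncard.choose 2 * (avoidHat N p b 3).ncard
      ≤ (Vk 0).ncard + (Vk 1).ncard + (Vk 2).ncard := by
        have e1 : 5 - 1 = 4 := rfl
        have e2 : 5 - 2 = 3 := rfl
        rw [e1] at h1; rw [e2] at h2
        omega
    _ = (Vk 0 ∪ Vk 1 ∪ Vk 2).ncard := hunion.symm
    _ ≤ V.ncard := Set.ncard_le_ncard (Set.union_subset (Set.union_subset (hVk 0) (hVk 1)) (hVk 2)) hVfin

end PercRepro
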